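import Summits.ResolutionOfSingularities.ResolutionOfSingularities.Theorems.FrobeniusLadderFInjectiveMacaulayficationBlowupFiModelOfCover
import Summits.ResolutionOfSingularities.ResolutionOfSingularities.Theorems.FrobeniusLadderFInjectiveMacaulayficationIsoLocusTransport
import Summits.ResolutionOfSingularities.ResolutionOfSingularities.Theorems.FrobeniusLadderFInjectiveMacaulayficationBadMaximalPoints
import Summits.ResolutionOfSingularities.ResolutionOfSingularities.Theorems.FrobeniusLadderFInjectiveMacaulayficationReesChartCongr
import Summits.ResolutionOfSingularities.ResolutionOfSingularities.Theorems.FrobeniusLadderFInjectiveMacaulayficationE8Char5FiModel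
import Literature.AlgebraicGeometry.Resolution.BlowupsIntegral
import Mathlib.Algebra.CharP.Algebra
import HarnessLib

/-!
# §2c (iii) — THE CERTIFIED-CHART CLASS TRANSPORTS ALONG BLOWING UPS OFF THE CENTRE (crux `FInjectiveMacaulayfication`, T-𝒫)

Support file for crux stmt-ResolutionOfSingularities-15315 (`FrobeniusLadder.FInjectiveMacaulayfication`), chain w45a, seat
res-L1-w45a-stub-7 (= res-D-pv-019). [OURS · L1 W4.5a] — NOT a statement of the manuscript under review; AI-written, weaker than
expert review. Statement = `L/w45a/ClassGlueSig.lean` v2 sha16 239444958d057f2d §2c `stub_certifiedChartClass_transport` VERBATIM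
(name without `stub_`; owner table res-L1-w45a-plan-1 06:37:30Z, ACKS ×4 (1) 06:38:40Z). It is hypothesis (iii) of G-β-rel
(`SequentialSurgeryGlueOfClass.sequentialSurgeryGlueOfClass`, p505685) for the CERTIFIED-CHART class `P_cert`.

STATEMENT. `P_cert X f b`: inside every open `W ∋ b` there is an affine open `U ∋ b`, `U ≤ W`, on which `b` is the only bad point,
with `char Γ(X, U) = p`, an ideal `I ≠ 0` of `Γ(X, U)` whose zero locus is `{b}` (`I ≤ 𝔭_x ↔ x = b` for `x ∈ U`) and a finite
family `v` in `I` whose Rees charts cover and whose affine blow-up algebras `Γ(U)[I/v_j]` satisfy the Cohen–Macaulay + Frobenius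
closed clause at maximal ideals containing `v_j/1`. CLAIM: for a blowing up `π : X' ⟶ X₁` along `J ≠ ⊥` and `x'` with
`π x' ∉ supp J`, `P_cert X₁ f₁ (π x')` implies `P_cert X' (π ≫ f₁) x'`.

PROOF. `π` is an isomorphism over `V := X₁ ∖ supp J` (`IsBlowup.isIso_compl`), so `g := π|_{π⁻¹V} : π⁻¹V → X₁` is an open
immersion (`IsBlowup.isOpenImmersion_preimage_compl_ι`). Given `W' ∋ x'`, the open `W := g(W' ∩ π⁻¹V) ∋ π x'` yields a certified
chart `U ≤ W` of `X₁`; as `U ⊆ V`, `π ∣_ U` is an isomorphism (`IsBlowup.isIso_morphismRestrict`), so `U' := π⁻¹U` is affine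
(`IsAffine.of_isIso`), `U' ≤ W'` (injectivity of `π` over `V`, `BadMaximalPoints.eq_of_base_eq_of_isIso_morphismRestrict`),
and `e := π^* : Γ(X₁, U) ≅ Γ(X', U')` is a ring isomorphism (`IsOpenImmersion.isIso_app`). Transport: `char p` along `e`;
`I' := e(I)`, `v' := e ∘ v` (non-zero, in `I'`); the zero locus by `IsAffineOpen.comap_primeIdealOf_appLE` (`e⁻¹ 𝔭_{y} = 𝔭_{π y}`)
and injectivity; the cover inequality through the induced ring map of Rees algebras `R[It] → R'[I't]` (built inside `reesCover_map`) and
`irrelevant_le_span_reesT`; the chart certificates by `ReesChartCongr.exists_blowupAlgebra_congr` +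
`E8Char5FiModel.clause_maximal_of_ringEquiv`; «alone bad» by `IsoLocusTransport.fClause_iff_of_isIso_morphismRestrict`.

* `reesCover_map` — the cover condition along a surjective ring map (Rees algebras coefficientwise);
* `blowupCertificates_map` — E6‴ chart certificates along a ring isomorphism;
* `certifiedChartClass_transport` — the §2c (iii) statement.

No definitions (the ring map of Rees algebras is built inside the proof of `reesCover_map`), no named facts, no `sorry`.
[folklore]
-/

-- single-problem summit: the doubled namespace component is forced
set_option linter.dupNamespace false

noncomputable section

namespace Summit.ResolutionOfSingularities.ResolutionOfSingularities.Theorems.FInjectiveMacaulayfication.CertifiedChartTransport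

open AlgebraicGeometry CategoryTheory Literature.AlgebraicGeometry.Resolution TopologicalSpace Polynomial
open Summit.ResolutionOfSingularities.ResolutionOfSingularities.Theorems.FInjectiveMacaulayfication

/-! ## Rees algebras and the cover condition along a ring map -/

/-- **The cover condition moves along a surjective ring map.** If `φ : R → R'` maps `I` onto `I' = φ(I)` (we take
`I' := I.map φ` with `φ` surjective, e.g. a ring isomorphism) and the Rees charts `D₊(v_j t)` cover `Proj R[It]`, then the charts
`D₊(φ(v_j) t)` cover `Proj R'[I't]`: the ring map `R[It] → R'[I't]` induced by `φ` on polynomials (coefficientwise, `φ(Iⁱ) ⊆ I'ⁱ`)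
sends `b t ↦ φ(b) t` and ideals to ideals, and `R'[I't]₊` is generated by the `b' t`, `b' ∈ I'` (`irrelevant_le_span_reesT`).
[folklore] -/
theorem reesCover_map {R R' : Type} [CommRing R] [CommRing R'] (φ : R →+* R') (hφ : Function.Surjective φ)
    (I : Ideal R) {t : ℕ} (v : Fin t → R) (hv : ∀ j : Fin t, v j ∈ I)
    (hv' : ∀ j : Fin t, φ (v j) ∈ I.map φ)
    (hcov : (HomogeneousIdeal.irrelevant (reesGrading I)).toIdeal ≤
      (Ideal.span (Set.range fun j : Fin t => reesT (I := I) (v j) (hv j))).radical) :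
    (HomogeneousIdeal.irrelevant (reesGrading (I.map φ))).toIdeal ≤
      (Ideal.span (Set.range fun j : Fin t => reesT (I := I.map φ) (φ (v j)) (hv' j))).radical := by
  classical
  -- the induced ring map of Rees algebras
  have hmem : ∀ f : reesAlgebra I, Polynomial.map φ (f : R[X]) ∈ reesAlgebra (I.map φ) := by
    intro f
    rw [mem_reesAlgebra_iff]
    intro i
    rw [Polynomial.coeff_map, ← Ideal.map_pow]
    exact Ideal.mem_map_of_mem _ ((mem_reesAlgebra_iff _ _).mp f.2 i)
  let E : reesAlgebra I →+* reesAlgebra (I.map φ) :=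
    { toFun := fun f => ⟨Polynomial.map φ (f : R[X]), hmem f⟩
      map_one' := by ext1; simp
      map_mul' := fun f g => by ext1; simp [Polynomial.map_mul]
      map_zero' := by ext1; simp
      map_add' := fun f g => by ext1; simp [Polynomial.map_add] }
  have hE : ∀ (b : R) (hb : b ∈ I), E (reesT b hb) = reesT (I := I.map φ) (φ b) (Ideal.mem_map_of_mem _ hb) := by
    intro b hb
    ext1
    change Polynomial.map φ (monomial 1 b) = monomial 1 (φ b)
    rw [Polynomial.map_monomial]
  -- reduce to the generators `b' t`, `b' ∈ I' = φ(I)`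
  refine le_trans (irrelevant_le_span_reesT (I.map φ)) ?_
  rw [Ideal.span_le]
  rintro _ ⟨⟨b', hb'⟩, rfl⟩
  -- `b' = φ b` with `b ∈ I`
  have hb'' : b' ∈ I.map φ := hb'
  rw [Ideal.map, ← Ideal.submodule_span_eq] at hb''
  -- use the span induction through `Ideal.mem_map_iff_of_surjective`
  obtain ⟨b, hb, rfl⟩ := (Ideal.mem_map_iff_of_surjective φ hφ).mp hb'
  -- `(b t)` lies in the irrelevant ideal of `R[It]`, hence `(b t)^K ∈ (v_j t)`
  have hbt : reesT b hb ∈ (HomogeneousIdeal.irrelevant (reesGrading I)).toIdeal := by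
    rw [HomogeneousIdeal.mem_iff, HomogeneousIdeal.mem_irrelevant_iff, GradedRing.proj_apply,
      DirectSum.decompose_of_mem_ne (reesGrading I) (reesT_mem b hb) one_ne_zero]
  obtain ⟨K, hK⟩ := (Ideal.mem_radical_iff.mp (hcov hbt))
  -- push through `E`
  have hK' : E (reesT b hb) ^ K ∈ (Ideal.span (Set.range fun j : Fin t => reesT (I := I) (v j) (hv j))).map E := by
    rw [← map_pow]; exact Ideal.mem_map_of_mem _ hK
  rw [Ideal.map_span, ← Set.range_comp] at hK'
  have hrange : (E ∘ fun j : Fin t => reesT (I := I) (v j) (hv j)) =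
      fun j : Fin t => reesT (I := I.map φ) (φ (v j)) (hv' j) := by
    funext j; exact hE (v j) (hv j)
  rw [hrange, hE b hb] at hK'
  exact SetLike.mem_coe.mpr (Ideal.mem_radical_iff.mpr ⟨K, hK'⟩)

/-- **E6‴ chart certificates move along a ring isomorphism** (`ReesChartCongr.exists_blowupAlgebra_congr` +
`E8Char5FiModel.clause_maximal_of_ringEquiv`). [folklore] -/
theorem blowupCertificates_map (p : ℕ) {R R' : Type} [CommRing R] [CommRing R'] (e : R ≃+* R') (φ : R →+* R')
    (heφ : ∀ r, e r = φ r) (I : Ideal R) (a : R)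
    (h : ∀ (Q : Ideal (Literature.AlgebraicGeometry.Resolution.blowupAlgebra I a)) [Q.IsMaximal],
      algebraMap R (Literature.AlgebraicGeometry.Resolution.blowupAlgebra I a) a ∈ Q → ∀ d : ℕ, ringKrullDim (Localization.AtPrime Q) = d → ∀ s : Fin d → Localization.AtPrime Q, (Ideal.span (Set.range s)).radical.IsMaximal → RingTheory.Sequence.IsWeaklyRegular (Localization.AtPrime Q) (List.ofFn s) ∧ ∀ y : Localization.AtPrime Q, (∃ e : ℕ, y ^ p ^ e ∈ Ideal.span ((fun z : Localization.AtPrime Q => z ^ p ^ e) '' (Ideal.span (Set.range s) : Set (Localization.AtPrime Q)))) → y ∈ Ideal.span (Set.range s)) :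
    ∀ (Q : Ideal (Literature.AlgebraicGeometry.Resolution.blowupAlgebra (I.map φ) (φ a))) [Q.IsMaximal],
      algebraMap R' (Literature.AlgebraicGeometry.Resolution.blowupAlgebra (I.map φ) (φ a)) (φ a) ∈ Q → ∀ d : ℕ, ringKrullDim (Localization.AtPrime Q) = d → ∀ s : Fin d → Localization.AtPrime Q, (Ideal.span (Set.range s)).radical.IsMaximal → RingTheory.Sequence.IsWeaklyRegular (Localization.AtPrime Q) (List.ofFn s) ∧ ∀ y : Localization.AtPrime Q, (∃ e : ℕ, y ^ p ^ e ∈ Ideal.span ((fun z : Localization.AtPrime Q => z ^ p ^ e) '' (Ideal.span (Set.range s) : Set (Localization.AtPrime Q)))) → y ∈ Ideal.span (Set.range s) := by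
  have hφ : φ = (e : R →+* R') := RingHom.ext fun r => (heφ r).symm
  subst hφ
  obtain ⟨E₀, hE₀⟩ := ReesChartCongr.exists_blowupAlgebra_congr e I a
  -- read `E₀` at the coerced ring-hom spelling of `Ideal.map` / evaluation (definitionally the same)
  let E₁ : Literature.AlgebraicGeometry.Resolution.blowupAlgebra I a ≃+*
      Literature.AlgebraicGeometry.Resolution.blowupAlgebra (I.map (e : R →+* R')) ((e : R →+* R') a) := E₀
  have hE₁ : E₁ (algebraMap R _ a) = algebraMap R' _ ((e : R →+* R') a) := hE₀ a
  intro Q hQmax hQ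
  exact E8Char5FiModel.clause_maximal_of_ringEquiv p E₁ _ _ hE₁ (fun Q' hQ'm hQ' => @h Q' hQ'm hQ') Q hQ

/-! ## The transport -/

/-- **§2c (iii) — the certified-chart class transports along blowing ups off the centre** (`L/w45a/ClassGlueSig.lean` v2
239444958d057f2d `stub_certifiedChartClass_transport`, VERBATIM): see the module docstring. [folklore] -/
theorem certifiedChartClass_transport : ∀ (p : ℕ), p.Prime → ∀ (k : Type) [Field k] [CharP k p]
    (X₁ : Scheme.{0}) (f₁ : X₁ ⟶ Spec (.of k)),
      IsSeparated f₁ → LocallyOfFiniteType f₁ → QuasiCompact f₁ → IsIntegral X₁ →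
      (∀ x : X₁, ∀ d : ℕ, ringKrullDim (X₁.presheaf.stalk x) = d → ∀ s : Fin d → X₁.presheaf.stalk x, (Ideal.span (Set.range s)).radical.IsMaximal → RingTheory.Sequence.IsWeaklyRegular (X₁.presheaf.stalk x) (List.ofFn s)) →
      Set.Finite {x : X₁ | ¬ ∀ d : ℕ, ringKrullDim (X₁.presheaf.stalk x) = d → ∀ s : Fin d → X₁.presheaf.stalk x, (Ideal.span (Set.range s)).radical.IsMaximal → ∀ y : X₁.presheaf.stalk x, (∃ e : ℕ, y ^ p ^ e ∈ Ideal.span ((fun z : X₁.presheaf.stalk x => z ^ p ^ e) '' (Ideal.span (Set.range s) : Set (X₁.presheaf.stalk x)))) → y ∈ Ideal.span (Set.range s)} →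
      ∀ (J : X₁.IdealSheafData), J ≠ ⊥ → ∀ (X' : Scheme.{0}) (π : X' ⟶ X₁), Literature.AlgebraicGeometry.Resolution.IsBlowup π J →
        ∀ x' : X', π.base x' ∉ (J.support : Set X₁) →
        (∀ W : X₁.Opens, (π.base x') ∈ W → ∃ U : X₁.affineOpens, (U : X₁.Opens) ≤ W ∧ (π.base x') ∈ (U : X₁.Opens) ∧
        (∀ x : X₁, x ∈ (U : X₁.Opens) → x ≠ (π.base x') → ∀ d : ℕ, ringKrullDim (X₁.presheaf.stalk x) = d → ∀ s : Fin d → X₁.presheaf.stalk x, (Ideal.span (Set.range s)).radical.IsMaximal → ∀ y : X₁.presheaf.stalk x, (∃ e : ℕ, y ^ p ^ e ∈ Ideal.span ((fun z : X₁.presheaf.stalk x => z ^ p ^ e) '' (Ideal.span (Set.range s) : Set (X₁.presheaf.stalk x)))) → y ∈ Ideal.span (Set.range s)) ∧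
        CharP Γ(X₁, U) p ∧ ∃ (I : Ideal Γ(X₁, U)), I ≠ ⊥ ∧
        (∀ (x : X₁) (hx : x ∈ (U : X₁.Opens)), I ≤ (U.2.primeIdealOf ⟨x, hx⟩).asIdeal ↔ x = (π.base x')) ∧
        ∃ (t : ℕ) (v : Fin t → Γ(X₁, U)) (hv : ∀ j : Fin t, v j ∈ I),
          (HomogeneousIdeal.irrelevant (reesGrading I)).toIdeal ≤ (Ideal.span (Set.range fun j : Fin t => reesT (I := I) (v j) (hv j))).radical ∧
          (∀ j : Fin t, v j ≠ 0) ∧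
          ∀ (j : Fin t) (Q : Ideal (Literature.AlgebraicGeometry.Resolution.blowupAlgebra I (v j))) [Q.IsMaximal],
            algebraMap Γ(X₁, U) (Literature.AlgebraicGeometry.Resolution.blowupAlgebra I (v j)) (v j) ∈ Q →
            ∀ d : ℕ, ringKrullDim (Localization.AtPrime Q) = d → ∀ s : Fin d → Localization.AtPrime Q, (Ideal.span (Set.range s)).radical.IsMaximal → RingTheory.Sequence.IsWeaklyRegular (Localization.AtPrime Q) (List.ofFn s) ∧ ∀ y : Localization.AtPrime Q, (∃ e : ℕ, y ^ p ^ e ∈ Ideal.span ((fun z : Localization.AtPrime Q => z ^ p ^ e) '' (Ideal.span (Set.range s) : Set (Localization.AtPrime Q)))) → y ∈ Ideal.span (Set.range s)) →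
        (∀ W : X'.Opens, x' ∈ W → ∃ U : X'.affineOpens, (U : X'.Opens) ≤ W ∧ x' ∈ (U : X'.Opens) ∧
        (∀ x : X', x ∈ (U : X'.Opens) → x ≠ x' → ∀ d : ℕ, ringKrullDim (X'.presheaf.stalk x) = d → ∀ s : Fin d → X'.presheaf.stalk x, (Ideal.span (Set.range s)).radical.IsMaximal → ∀ y : X'.presheaf.stalk x, (∃ e : ℕ, y ^ p ^ e ∈ Ideal.span ((fun z : X'.presheaf.stalk x => z ^ p ^ e) '' (Ideal.span (Set.range s) : Set (X'.presheaf.stalk x)))) → y ∈ Ideal.span (Set.range s)) ∧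
        CharP Γ(X', U) p ∧ ∃ (I : Ideal Γ(X', U)), I ≠ ⊥ ∧
        (∀ (x : X') (hx : x ∈ (U : X'.Opens)), I ≤ (U.2.primeIdealOf ⟨x, hx⟩).asIdeal ↔ x = x') ∧
        ∃ (t : ℕ) (v : Fin t → Γ(X', U)) (hv : ∀ j : Fin t, v j ∈ I),
          (HomogeneousIdeal.irrelevant (reesGrading I)).toIdeal ≤ (Ideal.span (Set.range fun j : Fin t => reesT (I := I) (v j) (hv j))).radical ∧
          (∀ j : Fin t, v j ≠ 0) ∧
          ∀ (j : Fin t) (Q : Ideal (Literature.AlgebraicGeometry.Resolution.blowupAlgebra I (v j))) [Q.IsMaximal],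
            algebraMap Γ(X', U) (Literature.AlgebraicGeometry.Resolution.blowupAlgebra I (v j)) (v j) ∈ Q →
            ∀ d : ℕ, ringKrullDim (Localization.AtPrime Q) = d → ∀ s : Fin d → Localization.AtPrime Q, (Ideal.span (Set.range s)).radical.IsMaximal → RingTheory.Sequence.IsWeaklyRegular (Localization.AtPrime Q) (List.ofFn s) ∧ ∀ y : Localization.AtPrime Q, (∃ e : ℕ, y ^ p ^ e ∈ Ideal.span ((fun z : Localization.AtPrime Q => z ^ p ^ e) '' (Ideal.span (Set.range s) : Set (Localization.AtPrime Q)))) → y ∈ Ideal.span (Set.range s))  := by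
  intro p hp k _ _ X₁ f₁ hsep hft hqc hint hCM hfin J hJ0 X' π hπ x' hx' hcert W' hxW'
  classical
  haveI : Fact p.Prime := ⟨hp⟩
  -- `π` is an isomorphism over the complement `V` of the centre; `g := π|_{π⁻¹V}` is an open immersion
  let V : X₁.Opens := centreCompl J
  haveI hisoV : IsIso (π ∣_ V) := hπ.isIso_compl
  haveI hg : IsOpenImmersion ((π ⁻¹ᵁ V).ι ≫ π) := hπ.isOpenImmersion_preimage_compl_ι
  have hx'V : π.base x' ∈ V := hx'
  -- every point of `V` is hit exactly once
  have hinj : ∀ y z : X', π.base y ∈ V → π.base z ∈ V → π.base y = π.base z → y = z :=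
    fun y z hy hz h => BadMaximalPoints.eq_of_base_eq_of_isIso_morphismRestrict π V y z hy hz h
  -- the open `W := g (W' ∩ π⁻¹V)` of `X₁`
  let W : X₁.Opens := ((π ⁻¹ᵁ V).ι ≫ π) ''ᵁ ((π ⁻¹ᵁ V).ι ⁻¹ᵁ W')
  have hWdef : (W : Set X₁) = π.base '' {z : X' | π.base z ∈ V ∧ z ∈ W'} := by
    ext y
    constructor
    · rintro ⟨z, hz, rfl⟩
      exact ⟨z.1, ⟨z.2, hz⟩, by simp [Scheme.Hom.comp_base]⟩
    · rintro ⟨z, ⟨hzV, hzW⟩, rfl⟩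
      exact ⟨⟨z, hzV⟩, hzW, by simp [Scheme.Hom.comp_base]⟩
  have hxW : π.base x' ∈ W := by
    rw [← SetLike.mem_coe, hWdef]; exact ⟨x', ⟨hx'V, hxW'⟩, rfl⟩
  have hWV : (W : Set X₁) ⊆ V := by
    rw [hWdef]; rintro _ ⟨z, ⟨hzV, -⟩, rfl⟩; exact hzV
  -- a certified chart `U ≤ W` of `X₁` around `π x'`
  obtain ⟨U, hUW, hxU, halone, hchar, I, hI0, hzero, t, v, hv, hcov, hv0, hcertv⟩ := hcert W hxW
  have hUV : (U : Set X₁) ⊆ (V : Set X₁) := fun y hy => hWV (hUW hy)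
  -- `π ∣_ U` is an isomorphism, so `U' := π⁻¹U` is an affine open of `X'` and `π^*` a ring isomorphism on sections
  have hdisj : Disjoint ((U : X₁.Opens) : Set X₁) (J.support : Set X₁) := by
    rw [Set.disjoint_left]; intro y hy hyJ; exact hUV hy hyJ
  haveI hisoU : IsIso (π ∣_ (U : X₁.Opens)) := hπ.isIso_morphismRestrict hdisj
  haveI : IsAffine (U : X₁.Opens) := U.2
  have hU'aff : IsAffineOpen (π ⁻¹ᵁ (U : X₁.Opens)) := IsAffine.of_isIso (π ∣_ (U : X₁.Opens))
  -- the ring isomorphism `e : Γ(X₁, U) ≃+* Γ(X', π⁻¹ U)`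
  have hUrange : (U : X₁.Opens) ≤ ((π ⁻¹ᵁ V).ι ≫ π).opensRange := by
    intro y hy
    obtain ⟨z, hz⟩ := BadMaximalPoints.exists_base_eq_of_isIso_morphismRestrict π V y (hUV hy)
    refine ⟨⟨z, show π.base z ∈ V from hz ▸ hUV hy⟩, ?_⟩
    simp [Scheme.Hom.comp_base, hz]
  haveI hiso_gapp : IsIso (((π ⁻¹ᵁ V).ι ≫ π).app (U : X₁.Opens)) := ((π ⁻¹ᵁ V).ι ≫ π).isIso_app _ hUrange
  have hUV' : π ⁻¹ᵁ (U : X₁.Opens) ≤ (π ⁻¹ᵁ V).ι.opensRange := by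
    rw [Scheme.Opens.opensRange_ι]; exact fun z hz => hUV hz
  haveI : IsIso ((π ⁻¹ᵁ V).ι.app (π ⁻¹ᵁ (U : X₁.Opens))) := (π ⁻¹ᵁ V).ι.isIso_app _ hUV'
  haveI hiso_app : IsIso (π.app (U : X₁.Opens)) := by
    have hcomp : ((π ⁻¹ᵁ V).ι ≫ π).app (U : X₁.Opens) =
        π.app (U : X₁.Opens) ≫ (π ⁻¹ᵁ V).ι.app (π ⁻¹ᵁ (U : X₁.Opens)) := Scheme.Hom.comp_app _ _ _
    haveI : IsIso (π.app (U : X₁.Opens) ≫ (π ⁻¹ᵁ V).ι.app (π ⁻¹ᵁ (U : X₁.Opens))) := hcomp ▸ hiso_gapp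
    exact IsIso.of_isIso_comp_right (π.app (U : X₁.Opens)) ((π ⁻¹ᵁ V).ι.app (π ⁻¹ᵁ (U : X₁.Opens)))
  let e : Γ(X₁, (U : X₁.Opens)) ≃+* Γ(X', π ⁻¹ᵁ (U : X₁.Opens)) := (asIso (π.app (U : X₁.Opens))).commRingCatIsoToRingEquiv
  let φ : Γ(X₁, (U : X₁.Opens)) →+* Γ(X', π ⁻¹ᵁ (U : X₁.Opens)) := (π.app (U : X₁.Opens)).hom
  have heφ : ∀ r, e r = φ r := fun r => rfl
  have hφinj : Function.Injective φ := fun a b h => e.injective (by rw [heφ, heφ]; exact h)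
  have hφsurj : Function.Surjective φ := fun b => by
    obtain ⟨a, ha⟩ := e.surjective b
    exact ⟨a, by rw [← heφ]; exact ha⟩
  -- the pieces of the new certified chart
  have hle : ((⟨π ⁻¹ᵁ (U : X₁.Opens), hU'aff⟩ : X'.affineOpens) : X'.Opens) ≤ W' := by
    intro z hz
    have hzU : π.base z ∈ (U : X₁.Opens) := hz
    have hzW : π.base z ∈ W := hUW hzU
    rw [← SetLike.mem_coe, hWdef] at hzW
    obtain ⟨z₀, ⟨hz₀V, hz₀W⟩, hzz⟩ := hzW
    rwa [← hinj z₀ z hz₀V (hUV hzU) hzz]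
  have halone' : ∀ z : X', z ∈ ((⟨π ⁻¹ᵁ (U : X₁.Opens), hU'aff⟩ : X'.affineOpens) : X'.Opens) → z ≠ x' → ∀ d : ℕ, ringKrullDim (X'.presheaf.stalk z) = d → ∀ s : Fin d → X'.presheaf.stalk z, (Ideal.span (Set.range s)).radical.IsMaximal → ∀ y : X'.presheaf.stalk z, (∃ e : ℕ, y ^ p ^ e ∈ Ideal.span ((fun z : X'.presheaf.stalk z => z ^ p ^ e) '' (Ideal.span (Set.range s) : Set (X'.presheaf.stalk z)))) → y ∈ Ideal.span (Set.range s) := by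
    intro z hz hne
    have hzU : π.base z ∈ (U : X₁.Opens) := hz
    have hne' : π.base z ≠ π.base x' := fun h => hne (hinj z x' (hUV hzU) hx'V h)
    exact (IsoLocusTransport.fClause_iff_of_isIso_morphismRestrict p π V z (hUV hzU)).mp (halone _ hzU hne')
  have hchar' : CharP Γ(X', ((⟨π ⁻¹ᵁ (U : X₁.Opens), hU'aff⟩ : X'.affineOpens) : X'.Opens)) p := by
    haveI := hchar
    exact charP_of_injective_ringHom (f := φ) hφinj p
  have hI0' : I.map φ ≠ ⊥ := fun h0 => hI0 ((Ideal.map_eq_bot_iff_of_injective hφinj).mp h0)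
  have hzero' : ∀ (z : X') (hz : z ∈ ((⟨π ⁻¹ᵁ (U : X₁.Opens), hU'aff⟩ : X'.affineOpens) : X'.Opens)),
      I.map φ ≤ (hU'aff.primeIdealOf ⟨z, hz⟩).asIdeal ↔ z = x' := by
    intro z hz
    have hzU : π.base z ∈ (U : X₁.Opens) := hz
    have hcomap := IsAffineOpen.comap_primeIdealOf_appLE (f := π) (x := z) (U : X₁.Opens) U.2
      (π ⁻¹ᵁ (U : X₁.Opens)) hU'aff le_rfl hz
    rw [Scheme.Hom.appLE_eq_app] at hcomap
    have hc : Ideal.comap φ (hU'aff.primeIdealOf ⟨z, hz⟩).asIdeal = (U.2.primeIdealOf ⟨π.base z, hzU⟩).asIdeal :=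
      congrArg PrimeSpectrum.asIdeal hcomap
    rw [Ideal.map_le_iff_le_comap, hc, hzero (π.base z) hzU]
    exact ⟨fun h => hinj z x' (hUV hzU) hx'V h, fun h => by rw [h]⟩
  have hv' : ∀ j : Fin t, φ (v j) ∈ I.map φ := fun j => Ideal.mem_map_of_mem _ (hv j)
  have hcov' := reesCover_map φ hφsurj I v hv hv' hcov
  have hv0' : ∀ j : Fin t, φ (v j) ≠ 0 := fun j => (map_ne_zero_iff φ hφinj).mpr (hv0 j)
  have hcert' : ∀ (j : Fin t) (Q : Ideal (Literature.AlgebraicGeometry.Resolution.blowupAlgebra (I.map φ) (φ (v j)))) [Q.IsMaximal],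
      algebraMap _ (Literature.AlgebraicGeometry.Resolution.blowupAlgebra (I.map φ) (φ (v j))) (φ (v j)) ∈ Q → ∀ d : ℕ, ringKrullDim (Localization.AtPrime Q) = d → ∀ s : Fin d → Localization.AtPrime Q, (Ideal.span (Set.range s)).radical.IsMaximal → RingTheory.Sequence.IsWeaklyRegular (Localization.AtPrime Q) (List.ofFn s) ∧ ∀ y : Localization.AtPrime Q, (∃ e : ℕ, y ^ p ^ e ∈ Ideal.span ((fun z : Localization.AtPrime Q => z ^ p ^ e) '' (Ideal.span (Set.range s) : Set (Localization.AtPrime Q)))) → y ∈ Ideal.span (Set.range s) := by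
    intro j
    exact blowupCertificates_map p e φ heφ I (v j) (hcertv j)
  exact ⟨⟨π ⁻¹ᵁ (U : X₁.Opens), hU'aff⟩, hle, hxU, halone', hchar', I.map φ, hI0', hzero', t, fun j => φ (v j), hv',
    hcov', hv0', hcert'⟩

end Summit.ResolutionOfSingularities.ResolutionOfSingularities.Theorems.FInjectiveMacaulayfication.CertifiedChartTransport

end
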